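import Summits.AtomisticToContinuum.FouriersLaw.Theorems.PhononMeanFreePathIncoherentChannelLightConeHelper7

/-!
# Light-cone stub, helper 8: the propagation functional `D_N(t)` in Gibbs mean

Helper for the registered stub `stub_lightCone` of line `two-horizons-forecast-loss`
(crux `PhononMeanFreePath.IncoherentChannel`, stmt-AtomisticToContinuum-11811), registered sub-goal
`lightCone_propagation_mean`.

The reduction (`lightCone_reduction`) left the single functional
`D_N(t) = ∫ (v_t(z) - v_t(z̃))² d(μ₀ ⊗ N(0,T))`, `v_t = fcast = K_t p_N` the mean forecast of the far
momentum, `z̃` = `z` with `p₀` resampled. Since `v_t(z) = E_W[p_N(Φ_t(z, B))]` (the kernel is the law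
of the solution map), Jensen in the noise gives `(v_t(z) - v_t(z̃))² ≤ E_W[(p_N(t) - p̃_N(t))²]`
for the two copies driven by the SAME noise, and helper 7 bounds the Gibbs mean of the right side:

  `D_N(t) ≤ 4T e^{Λ}Λ^N/N! + C t^{2^k} √(N+1) / Λ^{2^k}`   (all `N`, `t ≥ 0`, `Λ > 0`)

(`lightCone_propagation_mean`).
-/

noncomputable section

namespace Summit.AtomisticToContinuum.FouriersLaw.Theorems.PhononMeanFreePath

open MeasureTheory ProbabilityTheory Set Filter Topology
open scoped NNReal ENNReal
open Literature.MathematicalPhysics.KineticTheory.HeatConduction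
open Literature.MathematicalPhysics.KineticTheory Literature.Probability.Process OscillatorChain
open Summit.AtomisticToContinuum.FouriersLaw.Theorems.IncoherentChannel.Negative.KernelMoments
  (integrable_sq_momentum_transitionKernel integrable_momentum_transitionKernel)

section Bridge

variable {ω₂ lam β γ T : ℝ} (hω : 0 < ω₂) (hl : 0 ≤ lam) (hβ : 0 ≤ β) (hγ : 0 ≤ γ) (hT : 0 < T) (N : ℕ)
include hω hl hβ hγ hT

/-- The far momentum of the solution map is `W`-integrable together with its square, for every
initial state (moments of the transition kernel, `K_t(z,·) = law(Φ_t(z,B))`). -/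
theorem lightCone_integrable_far_solMap (t : ℝ≥0) (z : PhaseSpace (N + 1)) :
    Integrable (fun ω : WienerPair => ((pinnedChain ω₂ lam β γ).solMap (N + 1) T T t z (pairPath ω)).2 (Fin.last N)) wienerPair ∧
      Integrable (fun ω : WienerPair => (((pinnedChain ω₂ lam β γ).solMap (N + 1) T T t z (pairPath ω)).2 (Fin.last N)) ^ 2)
        wienerPair := by
  have hK := pinnedChain_transitionKernel_apply hω hl hβ hγ (N + 1) T T t z
  have hΦ := pinnedChain_measurable_solMap_pairPath_right hω hl hβ hγ (N + 1) T T t z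
  have h1 := integrable_momentum_transitionKernel hω hl hβ hγ (Nat.succ_pos N) hT t z (Fin.last N)
  have h2 := integrable_sq_momentum_transitionKernel hω hl hβ hγ (Nat.succ_pos N) hT t z (Fin.last N)
  rw [hK] at h1 h2
  exact ⟨(integrable_map_measure (by fun_prop : Continuous fun y : PhaseSpace (N + 1) => y.2 (Fin.last N)).aestronglyMeasurable
      hΦ.aemeasurable).1 h1,
    (integrable_map_measure (by fun_prop : Continuous fun y : PhaseSpace (N + 1) => y.2 (Fin.last N) ^ 2).aestronglyMeasurable
      hΦ.aemeasurable).1 h2⟩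

omit hT in
/-- The mean forecast is the noise average of the far momentum of the solution map:
`v_t(z) = ∫ p_N(Φ_t(z, B(ω))) dW(ω)` (`t ≥ 0`). -/
theorem lightCone_fcast_eq_integral_solMap {t : ℝ} (ht : 0 ≤ t) (z : PhaseSpace (N + 1)) :
    fcast ω₂ lam β γ T N t z =
      ∫ ω, ((pinnedChain ω₂ lam β γ).solMap (N + 1) T T t z (pairPath ω)).2 (Fin.last N) ∂wienerPair := by
  have h := pinnedChain_integral_transitionKernel hω hl hβ hγ (N + 1) T T t.toNNReal z
    (g := fun y : PhaseSpace (N + 1) => y.2 (Fin.last N)) (by fun_prop : Continuous fun y : PhaseSpace (N + 1) =>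
      y.2 (Fin.last N)).aestronglyMeasurable
  rw [Real.coe_toNNReal t ht] at h
  exact h

/-- **Jensen in the noise**: `(v_t(z) - v_t(z̃))² ≤ ∫ (p_N(Φ_t(z,B)) - p_N(Φ_t(z̃,B)))² dW` — the two
copies are driven by the SAME Brownian pair. -/
theorem lightCone_fcast_sub_sq_le {t : ℝ} (ht : 0 ≤ t) (z z' : PhaseSpace (N + 1)) :
    (fcast ω₂ lam β γ T N t z - fcast ω₂ lam β γ T N t z') ^ 2 ≤
      ∫ ω, (((pinnedChain ω₂ lam β γ).solMap (N + 1) T T t z (pairPath ω)).2 (Fin.last N) -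
        ((pinnedChain ω₂ lam β γ).solMap (N + 1) T T t z' (pairPath ω)).2 (Fin.last N)) ^ 2 ∂wienerPair := by
  set tN : ℝ≥0 := ⟨t, ht⟩ with htN
  have htt : ((tN : ℝ≥0) : ℝ) = t := rfl
  obtain ⟨h1, h2⟩ := lightCone_integrable_far_solMap hω hl hβ hγ hT N tN z
  obtain ⟨h1', h2'⟩ := lightCone_integrable_far_solMap hω hl hβ hγ hT N tN z'
  rw [htt] at h1 h2 h1' h2'
  rw [lightCone_fcast_eq_integral_solMap hω hl hβ hγ N ht z, lightCone_fcast_eq_integral_solMap hω hl hβ hγ N ht z',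
    ← integral_sub h1 h1']
  refine lightCone_sq_integral_le (h1.sub h1').aestronglyMeasurable ?_
  refine ((h2.add h2').const_mul 2).mono' ((h1.sub h1').aestronglyMeasurable.pow 2) (Eventually.of_forall fun ω => ?_)
  rw [Real.norm_eq_abs, abs_of_nonneg (sq_nonneg _)]
  simp only [Pi.add_apply]
  nlinarith [sq_nonneg ((((pinnedChain ω₂ lam β γ).solMap (N + 1) T T t z (pairPath ω)).2 (Fin.last N)) +
    (((pinnedChain ω₂ lam β γ).solMap (N + 1) T T t z' (pairPath ω)).2 (Fin.last N)))]

/-- **Bridge**: the propagation functional is dominated by the Gibbs-mean pathwise discrepancy: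
if `E[(p_N(t) - p̃_N(t))²] ≤ b` (lintegral form, `b ≥ 0`) then `D_N(t) ≤ b`. -/
theorem lightCone_D_le_of_lintegral_le {t : ℝ} (ht : 0 ≤ t) {b : ℝ} (hb : 0 ≤ b)
    (hE : ∫⁻ q : (PhaseSpace (N + 1) × ℝ) × WienerPair,
        ENNReal.ofReal ((((pinnedChain ω₂ lam β γ).solMap (N + 1) T T t q.1.1 (pairPath q.2)).2 (Fin.last N) -
          ((pinnedChain ω₂ lam β γ).solMap (N + 1) T T t
            ((q.1.1.1, Function.update q.1.1.2 0 q.1.2) : PhaseSpace (N + 1)) (pairPath q.2)).2 (Fin.last N)) ^ 2)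
        ∂((((pinnedChain ω₂ lam β γ).gibbsMeasure (N + 1) T).prod (gaussianReal 0 T.toNNReal)).prod wienerPair) ≤
      ENNReal.ofReal b) :
    ∫ x : PhaseSpace (N + 1) × ℝ, (fcast ω₂ lam β γ T N t x.1 -
        fcast ω₂ lam β γ T N t ((x.1.1, Function.update x.1.2 0 x.2) : PhaseSpace (N + 1))) ^ 2
        ∂(((pinnedChain ω₂ lam β γ).gibbsMeasure (N + 1) T).prod (gaussianReal 0 T.toNNReal)) ≤ b := by
  set P := pinnedChain ω₂ lam β γ with hP
  set μ := (P.gibbsMeasure (N + 1) T).prod (gaussianReal 0 T.toNNReal) with hμ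
  set v := fcast ω₂ lam β γ T N t with hv
  have hvm : Measurable v := lightCone_measurable_fcast ω₂ lam β γ T N t
  set g : PhaseSpace (N + 1) × ℝ → ℝ := fun x => (v x.1 - v ((x.1.1, Function.update x.1.2 0 x.2) : PhaseSpace (N + 1))) ^ 2 with hg
  have hgm : Measurable g := ((hvm.comp measurable_fst).sub (hvm.comp (lightCone_measurable_resample 0))).pow_const 2
  have hg0 : ∀ x, 0 ≤ g x := fun x => sq_nonneg _
  -- the discrepancy as a function of `q`
  set δ : (PhaseSpace (N + 1) × ℝ) × WienerPair → ℝ := fun q =>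
    (P.solMap (N + 1) T T t q.1.1 (pairPath q.2)).2 (Fin.last N) -
      (P.solMap (N + 1) T T t ((q.1.1.1, Function.update q.1.1.2 0 q.1.2) : PhaseSpace (N + 1)) (pairPath q.2)).2 (Fin.last N)
    with hδ
  have hδm : Measurable δ :=
    (((measurable_pi_apply _).comp measurable_snd).comp (lightCone_measurable_solMap_fst hω hl hβ hγ N T t)).sub
      (((measurable_pi_apply _).comp measurable_snd).comp (lightCone_measurable_solMap_resample hω hl hβ hγ N T t))
  -- pointwise Jensen
  have hpt : ∀ x : PhaseSpace (N + 1) × ℝ, ENNReal.ofReal (g x) ≤ ∫⁻ ω, ENNReal.ofReal (δ (x, ω) ^ 2) ∂wienerPair := by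
    intro x
    have hJ := lightCone_fcast_sub_sq_le hω hl hβ hγ hT N ht x.1 ((x.1.1, Function.update x.1.2 0 x.2) : PhaseSpace (N + 1))
    set tN : ℝ≥0 := ⟨t, ht⟩ with htN
    have htt : ((tN : ℝ≥0) : ℝ) = t := rfl
    obtain ⟨h1, h2⟩ := lightCone_integrable_far_solMap hω hl hβ hγ hT N tN x.1
    obtain ⟨h1', h2'⟩ := lightCone_integrable_far_solMap hω hl hβ hγ hT N tN ((x.1.1, Function.update x.1.2 0 x.2) : PhaseSpace (N + 1))
    rw [htt] at h1 h2 h1' h2'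
    have hint : Integrable (fun ω => δ (x, ω) ^ 2) wienerPair := by
      refine ((h2.add h2').const_mul 2).mono' ((h1.sub h1').aestronglyMeasurable.pow 2) (Eventually.of_forall fun ω => ?_)
      rw [Real.norm_eq_abs, abs_of_nonneg (sq_nonneg _)]
      simp only [Pi.add_apply, hδ]
      nlinarith [sq_nonneg (((P.solMap (N + 1) T T t x.1 (pairPath ω)).2 (Fin.last N)) +
        ((P.solMap (N + 1) T T t ((x.1.1, Function.update x.1.2 0 x.2) : PhaseSpace (N + 1)) (pairPath ω)).2 (Fin.last N)))]
    rw [← ofReal_integral_eq_lintegral_ofReal hint (Eventually.of_forall fun ω => sq_nonneg _)]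
    exact ENNReal.ofReal_le_ofReal hJ
  -- integrate
  have hD : ∫ x, g x ∂μ = (∫⁻ x, ENNReal.ofReal (g x) ∂μ).toReal :=
    integral_eq_lintegral_of_nonneg_ae (Eventually.of_forall hg0) hgm.aestronglyMeasurable
  have hE' : ∫⁻ x, ENNReal.ofReal (g x) ∂μ ≤ ENNReal.ofReal b := by
    calc ∫⁻ x, ENNReal.ofReal (g x) ∂μ ≤ ∫⁻ x, ∫⁻ ω, ENNReal.ofReal (δ (x, ω) ^ 2) ∂wienerPair ∂μ := lintegral_mono hpt
      _ = ∫⁻ q, ENNReal.ofReal (δ q ^ 2) ∂(μ.prod wienerPair) :=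
          (lintegral_prod _ (hδm.pow_const 2).ennreal_ofReal.aemeasurable).symm
      _ ≤ ENNReal.ofReal b := hE
  change ∫ x, g x ∂μ ≤ b
  rw [hD]
  have := ENNReal.toReal_mono ENNReal.ofReal_ne_top hE'
  rwa [ENNReal.toReal_ofReal hb] at this

end Bridge

/-- **Registered helper `lightCone_propagation_mean` — the propagation functional of the reduction
is super-polynomially small inside the cone.** For `P = pinnedChain ω₂ lam β γ` (`ω₂ > 0`,
`lam, β, γ ≥ 0`), `T > 0` and every `k` there is `C ≥ 0` with, for all `N`, `t ≥ 0`, `Λ > 0`: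
`D_N(t) = ∫ (v_t(z) - v_t(z̃))² d(μ₀ ⊗ N(0,T)) ≤ 4T e^{Λ}Λ^N/N! + C t^{2^k} √(N+1)/Λ^{2^k}`. -/
theorem lightCone_propagation_mean : ∀ ω₂ lam β γ : ℝ, 0 < ω₂ → 0 ≤ lam → 0 ≤ β → 0 ≤ γ → ∀ T : ℝ, 0 < T →
    ∀ k : ℕ, ∃ C : ℝ, 0 ≤ C ∧ ∀ (N : ℕ) (t : ℝ), 0 ≤ t → ∀ Λ : ℝ, 0 < Λ →
      ∫ x : PhaseSpace (N + 1) × ℝ, (fcast ω₂ lam β γ T N t x.1 -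
          fcast ω₂ lam β γ T N t ((x.1.1, Function.update x.1.2 0 x.2) : PhaseSpace (N + 1))) ^ 2
          ∂(((pinnedChain ω₂ lam β γ).gibbsMeasure (N + 1) T).prod (ProbabilityTheory.gaussianReal 0 T.toNNReal)) ≤
        4 * T * (Real.exp Λ * Λ ^ N / N.factorial) + C * t ^ (2 ^ k) * Real.sqrt (N + 1) / Λ ^ (2 ^ k) := by
  intro ω₂ lam β γ hω hl hβ hγ T hT k
  obtain ⟨C, hC0, hC⟩ := lightCone_propagation_lintegral ω₂ lam β γ hω hl hβ hγ T hT k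
  refine ⟨C, hC0, fun N t ht Λ hΛ => ?_⟩
  refine lightCone_D_le_of_lintegral_le hω hl hβ hγ hT N ht (by positivity) (hC N t ht Λ hΛ)

end Summit.AtomisticToContinuum.FouriersLaw.Theorems.PhononMeanFreePath

end
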